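import Literature.MathematicalPhysics.QuantumFieldTheory.BalabanImbrieJaffe1984to88.BIJ88Eq5145HeadMultiCube
import Literature.MathematicalPhysics.QuantumFieldTheory.BalabanImbrieJaffe1984to88.BIJ88Ineq5144LocatedWitness
import Literature.MathematicalPhysics.QuantumFieldTheory.BalabanImbrieJaffe1984to88.BIJ88CutoffProfileWitness
import Literature.MathematicalPhysics.QuantumFieldTheory.BalabanImbrieJaffe1984to88.BIJ88SmallChargeRegime

/-!
# `BalabanImbrieJaffe1984to88.BIJ88Eq5145HeadMultiCubeSlots` — T. Bałaban, J. Imbrie, A. Jaffe, *Effective action and cluster properties of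
the abelian Higgs model*, Commun. Math. Phys. **114** (1988) 257–315 [BalabanImbrieJaffe1988], Sect. 5.14, (5.14.5) p. 312 [PDF 56] with (5.14.4)
p. 309 [PDF 53]: **THE MULTI-CUBE HEAD `BIJ88Eq5145HeadMultiCube.eq5145_zG_mod_W6v_of_ineq5144_two_le` INSTANTIATED — EVERY HYPOTHESIS
DISCHARGED ON EXPLICIT §5.13 DATA WITH χ-SLOTS** (the owner's switch criterion for the C2.Eq5.14.5 head pointer, r16 2026-08-22T18:29Z: *«one
proof-lane theorem instantiating `…_two_le` with every hypothesis discharged on explicit data»*).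

statement-level skeleton of published theorems with citation tags; proofs where landed; nothing here is a claim about the Yang–Mills mass gap

p. 309, verbatim: *"The proof of this estimate is similar to the one for g₂. … The bound for H_β = ∅, |X_β| = 1 was obtained for g₂, and the same
proof applies here."*  p. 305: *"□_i Δ_s □_{i′} = s_i s_{i′} □_i Δ □_{i′}"* (a single cube carries no interpolation parameter).  PDF held:
`paper:balaban1988-cmp114-bij-abelian-higgs-effective-action` (journal page = PDF page + 256); pp. 305, 309, 312 = PDF 49, 53, 56 read this generation.

PATH HISTORY: this text first landed as `BIJ88Eq5145HeadMultiCubeInstance.lean` (p338157, ACCEPTED commit be62e627dfd9, 2026-08-22T18:46Z); the row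
owner r16 gen 17 filed its own certificate `BIJ88Eq5145HeadMultiCubeInstance.lean` (p338195; no χ-slots, interaction off) on the same path 74 s
later, which replaced it; the five theorems are re-landed here VERBATIM under their own stem (namespace `…BIJ88Eq5145HeadMultiCubeSlots`).

WHAT IS REPRODUCED (unit `lit-balaban-p36`, generation 16 of the Phase-2 proof seat p36; SKELETON row **C2.Eq5.14.5** member cell of
`HOME/lit-balaban-r16/ROWS-C2-part2.md`, owner r16; row **C2.Eq5.14.3-5.14.4** member), theorems only:
* §1 **`actIn_eq_zero_of_two_le`**, **`abs_locAct_actIn_le_of_two_le`** — for a BLOCK-DIAGONAL precision `Δ` (no inter-cube coupling: `Δ` is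
  its own interpolation at every corner, `BIJ88Ineq5144LocatedWitness.interpForm_eq_self`) and ARBITRARY slot data (χ-slots `B`, slot fields `Φ`,
  thresholds `c`, interaction slots `Ys`, terms `V`, cube map), the located activity of every polymer with at least two cubes VANISHES (its
  `g₁` is a corner sum of a corner-independent expectation, `g1_eq_zero_of_two_le`), so the multi-cube part `h5144two` of the located leaf
  (5.14.4) holds for such data with any `0 < θ`, any `β′`;
* §2 **`eq5145_zG_mod_W6v_two_le_blockDiag`** — hence, for block-diagonal data, the head `eq5145_zG_mod_W6v_of_ineq5144_two_le` yields the
  (5.14.5) identity of record (`exp[−𝒫^L − Σ_X (W₆′(X) + W₆″(X))]`, `W₆′` as printed) with **NO (5.14.4) hypothesis at all** — only the one-cube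
  regime of `BIJ88Ineq5144OneCube` (all-orders derivative constant `Ĉ`, one-cube tails `A, κ`, `K_Y ≤ K₁`, `≤ G` slots per cube, the five
  `e_k`-smallness inequalities), gen 5's numerical regime, `hmod`, `h311` and the structural hypotheses;
* §3 **`eq5145_two_le_instance`** — §2 ON EXPLICIT DATA WITH χ-SLOTS: sites = cubes (`α = I`, `blk = id`), `Δ = 1`, `ℱ = 0`, ONE χ-SLOT PER
  CUBE whose slot field is the cube's site field (a linear functional, cube-local), thresholds `c ≡ 1`, no interaction terms, the profile
  `χ = gevreyCutoff` of `BIJ88CutoffProfileWitness`, `θ = √e_k`, `β′ = 1`, `𝒫^L = 0`, `W₆″_ρ(X′) = [X′ = ∅]·𝒫̃_ρ`: the tails by gen 13's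
  `BIJ88GaussShellModulus309.tail_slotField_fieldLaw_of_mod` under each one-cube law (mean `0` since `ℱ = 0`, gen 11's
  `integral_slotField_fieldLaw`; `A = 4`, `κ = 1/(8v)`, `v = 1 + Σ_i Var_i`), the all-orders constant `Ĉ(χ, p, n̄+1)` chosen FIRST, and the
  regime inequalities (incl. gen 5's `16(D+1)²e²θ^{β′/2} ≤ 1` and `e_k < e^{−1}`) for every `e_k` below a threshold `e₀ > 0`
  (`BIJ88SmallChargeRegime.exists_threshold`) — for any symmetric abutting relation of bounded degree, any `p > 1/2`, any cube-local `F`, any `n̄`;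
  conclusion = the (5.14.5) identity for these data, for all `e_k ∈ (0, e₀)`, all `W`, `B_large`, `|L′| = n̄+1`, `γ`;
* §4 **`eq5145_two_le_instance_fin2`** — §3 with everything fixed: TWO abutting cubes `I = Fin 2` (so two-cube polymers exist), `p = 1`, `F ≡ 1`,
  `n̄ = 0`, `L′ = Unit` — a CLOSED theorem `∃ e₀ > 0, ∀ e_k ∈ (0,e₀), ∀ W B_large γ, (5.14.5)`: the multi-cube head's hypothesis family is jointly
  satisfiable, kernel-checked, with the one-cube regime block discharged JOINTLY with `hsmall`/`h311`/`hmod`/`htail` of (5.14.5)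
  (cf. `BIJ88Eq5145LocatedInstance` p331132 for the located head p330573, and `BIJ88Ineq5144OneCubeInstance` p335871 for the one-cube theorem alone).
HONEST SCOPE: degenerate but legal data — with no inter-cube coupling the multi-cube activities are identically `0`, so the genuinely unproved
printed claim (the inductive cluster-expansion decay of (5.14.4) on `|X_β| ≥ 2` for COUPLED data, Claim@307 «|g₂(X_α) − 1| ≤ θ» across cubes) is
NOT touched; what is exercised non-vacuously is the one-cube theorem with χ-slots (Gaussian shells, t-derivatives of the cut-offs, the vacuum
subtraction) inside the (5.14.5) head.  A satisfiability certificate for OUR typed reading, not a step of the paper's argument.  0 `sorry`,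
0 definitions, 0 `Prop` facts (D-0026); imports `BIJ88Eq5145HeadMultiCube` (p36 g15), `BIJ88Ineq5144LocatedWitness` (p36 g14), `BIJ88CutoffProfileWitness`
(p36 g7), `BIJ88SmallChargeRegime` (p36 g6); modifies nothing.  NOT summit progress; NOT continuum; NOT Clay.  Cell `lit-balaban` Phase 2, seat p36
gen 16 (owner r16, referee ref-5).
-/

noncomputable section

open Finset MeasureTheory ProbabilityTheory Filter
open Literature.MathematicalPhysics.QuantumFieldTheory.BalabanImbrieJaffe1984to88
open BIJ88DirichletForms305 (interpForm)
open BIJ88PolymerRep5134 (g1 IsAdmissible corner)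
open BIJ88PolymerRep5134Gauss (ext expect zG prec)
open BIJ88Resummation5141 (outer lam12)
open BIJ88Resummation5141Adm (lam12')
open BIJ88Expansion5143 (g3 prime prime_of_not)
open BIJ88Expansion5143Gauss (fD)
open BIJ88SlotMomentsGauss308 (uD fieldLaw)
open BIJ88Sect2Statements (pLog)
open BIJ88Sect5Statements (CutoffProfile cutoff)
open BIJ88Sect5StatementsPart4 (pertP)
open BIJ88GaussIntegration309Product (exists_const_all_orders)
open BIJ88Eq5145CornerModel
open BIJ88Eq5145CornerUrsell (cubeIn)
open BIJ88W6PrimeVsupp (actIn W6v)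
open BIJ88Ineq5144Located (locAct locAct_eq_zero_of_eq_zero)
open BIJ88Ineq5144LocatedWitness (interpForm_eq_self g1_eq_zero_of_two_le)
open BIJ88CutoffProfileWitness (gevreyCutoff chi1_nonneg)
open BIJ88SmallChargeRegime (exists_threshold eventually_const_le_mul_log_rpow eventually_const_mul_le_one eventually_le_one)
open BIJ88Eq5145HeadMultiCube (eq5145_zG_mod_W6v_of_ineq5144_two_le)

namespace Literature.MathematicalPhysics.QuantumFieldTheory.BalabanImbrieJaffe1984to88.BIJ88Eq5145HeadMultiCubeSlots

/-! ## §1 Block-diagonal data: the located activity of every polymer with at least two cubes vanishes -/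

section BlockDiag

variable {α I : Type} [Fintype α] [DecidableEq α] [Fintype I] [DecidableEq I]
  (blk : α → I) {Δ : Matrix α α ℝ} (ℱ : α → ℝ)
variable (adj : I → I → Prop) [DecidableRel adj]
variable (χ : CutoffProfile) {ι υ : Type*} [DecidableEq ι] [DecidableEq υ]
variable (p ek : ℝ) (B : Finset ι) (Φ : ι → (α → ℝ) → ℝ) (c : ι → ℝ) (Ys : Finset υ) (V : υ → (α → ℝ) → ℝ)
variable (cube : ↥B ⊕ ↥Ys → I)

/-- **for a block-diagonal precision the prime-dropped activity of every polymer with at least two cubes is `0`** — whatever the slot data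
(p. 305: the interpolated form of a block-diagonal `Δ` is `Δ` at every corner, so the corner expectations do not see the corner and their
corner sum over a nonempty coordinate set vanishes; the prime only touches one-cube polymers). [cite: BalabanImbrieJaffe1988, (5.14.3)–(5.14.4) p.309; (5.13.3) p.305] -/
theorem actIn_eq_zero_of_two_le (hΔ0 : ∀ x y, blk x ≠ blk y → Δ x y = 0) (Λ X : Finset I) (t : ℝ) {L : Type*} [DecidableEq L]
    (γ : L → ↥(slotB B Ys cube X) ⊕ ↥(slotY B Ys cube X)) (H : Finset L) {X'' : Finset I} (h2 : 2 ≤ X''.card) :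
    actIn blk Δ ℱ adj χ p ek B Φ c Ys V cube Λ X t γ H X'' = 0 := by
  simp only [actIn]
  rw [prime_of_not _ (fun h => absurd h.2 (by omega)), g3]
  exact g1_eq_zero_of_two_le blk ℱ _ adj (fun x y hxy => by rw [interpForm_eq_self blk hΔ0]; exact hΔ0 x y hxy) h2

/-- **hence the multi-cube part `h5144two` of the located leaf (5.14.4) holds for block-diagonal data** (any `0 < θ`, any `β′`, any slot data,
corner, region, `t`, assignment): the located activity of a polymer with `≥ 2` cubes is `0 ≤ θ^{|H| + β′|X″ ∖ loc H|}`.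
[cite: BalabanImbrieJaffe1988, (5.14.4) p.309; (5.13.3) p.305] -/
theorem abs_locAct_actIn_le_of_two_le (hΔ0 : ∀ x y, blk x ≠ blk y → Δ x y = 0) {θ : ℝ} (hθ0 : 0 < θ) (β' : ℝ) (Λ X : Finset I) (t : ℝ)
    {L : Type*} [DecidableEq L] (γ : L → ↥(slotB B Ys cube X) ⊕ ↥(slotY B Ys cube X)) (H : Finset L) (X'' : Finset I) (h2 : 2 ≤ X''.card) :
    |locAct (cubeIn cube X ∘ γ) (actIn blk Δ ℱ adj χ p ek B Φ c Ys V cube Λ X t γ) H X''| ≤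
      θ ^ ((H.card : ℝ) + β' * ((X'' \ H.image (cubeIn cube X ∘ γ)).card : ℝ)) := by
  rw [locAct_eq_zero_of_eq_zero (actIn_eq_zero_of_two_le blk ℱ adj χ p ek B Φ c Ys V cube hΔ0 Λ X t γ H h2), abs_zero]
  exact Real.rpow_nonneg hθ0.le _

end BlockDiag

/-! ## §2 The multi-cube head for block-diagonal data: (5.14.5) with no leaf hypothesis, one-cube regime only -/

section Head

variable {α I : Type} [Fintype α] [DecidableEq α] [Fintype I] [DecidableEq I]
  (blk : α → I) (Δ : Matrix α α ℝ) (ℱ : α → ℝ)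
variable (adj : I → I → Prop) [DecidableRel adj]
variable (χ : CutoffProfile) {ι υ : Type*} [DecidableEq ι] [DecidableEq υ]
variable {p ek : ℝ} {B : Finset ι} {Φ : ι → (α → ℝ) → ℝ} {c : ι → ℝ} {Ys : Finset υ} {V : υ → (α → ℝ) → ℝ}
variable (cube : ↥B ⊕ ↥Ys → I) {L : Type*} (γ : L → ↥B ⊕ ↥Ys)

/-- **(5.14.5) ON THE MODEL FOR BLOCK-DIAGONAL DATA — NO (5.14.4) HYPOTHESIS**: the head `BIJ88Eq5145HeadMultiCube.eq5145_zG_mod_W6v_of_ineq5144_two_le`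
(conclusion verbatim: `exp[−𝒫^L − Σ_X (W₆′(X) + W₆″(X))]`, `W₆′` as printed) with its block-diagonality hypothesis `hΔ0 : blk x ≠ blk y → Δ x y = 0`
in place of `hΔadj`, and its multi-cube leaf hypothesis `h5144two` DISCHARGED by §1; what remains is the one-cube regime of `BIJ88Ineq5144OneCube`
(p. 309 *"The bound for H_β = ∅, |X_β| = 1 was obtained for g₂, and the same proof applies here"*), gen 5's regime, `hmod`, `h311` and structure.
[cite: BalabanImbrieJaffe1988, (5.14.5) p.312; (5.14.4) p.309; p.310 display 4; p.311; (5.13.3) p.305] -/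
theorem eq5145_zG_mod_W6v_two_le_blockDiag [Fintype ι] [Fintype υ] {nbr : I → Finset I} {D : ℕ} {θ β' : ℝ}
    (hR : ∀ x y, adj x y → adj y x) (hD : ∀ x, (nbr x).card ≤ D) (hnbr : ∀ x y, adj x y → y ∈ nbr x) (hθ0 : 0 < θ) (hθ1 : θ ≤ 1)
    (hβ : 0 ≤ β') (hsmall : 16 * ((D : ℝ) + 1) ^ 2 * (θ ^ (β' / 2) * Real.exp 2) ≤ 1)
    (hΔ0 : ∀ x y, blk x ≠ blk y → Δ x y = 0) (hΔ : Δ.PosDef)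
    (hχ : ∀ x, 0 ≤ χ.χ₁ x) (hp : 1 / 2 < p)
    (hmod : ∀ b ∈ B, ∃ ℓ₁ ℓ₂ : (α → ℝ) → ℝ, IsLinearMap ℝ ℓ₁ ∧ IsLinearMap ℝ ℓ₂ ∧
      ((∀ φ, Φ b φ = ℓ₁ φ) ∨ (∀ φ, Φ b φ = Real.sqrt (ℓ₁ φ ^ 2 + ℓ₂ φ ^ 2))))
    {c₀ : ℝ} (hc₀ : 0 < c₀) (hcb : ∀ b ∈ B, c₀ ≤ c b) (hV : ∀ Y ∈ Ys, Measurable (V Y)) {KY : υ → ℝ} (hK : ∀ Y ∈ Ys, ∀ φ, |V Y φ| ≤ KY Y)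
    (hek : 0 < ek) (hek1 : ek < Real.exp (-1))
    (hΦloc : ∀ b : B, ∀ φ ψ : α → ℝ, (∀ x, blk x = cube (Sum.inl b) → φ x = ψ x) → Φ b φ = Φ b ψ)
    (hVloc : ∀ Y : Ys, ∀ φ ψ : α → ℝ, (∀ x, blk x = cube (Sum.inr Y) → φ x = ψ x) → V Y φ = V Y ψ)
    (F : I → (α → ℝ) → ℝ) (hFloc : ∀ i (φ ψ : α → ℝ), (∀ x, blk x = i → φ x = ψ x) → F i φ = F i ψ)
    {L' : Type} [Fintype L'] [DecidableEq L'] {nbar : ℕ} (hL : Fintype.card L' = nbar + 1)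
    (W Bl : Finset I) (Vconst PL : ℝ) (W6pp : Finset (Finset I) → Finset I → ℝ)
    -- the one-cube regime of `BIJ88Ineq5144OneCube`
    {C : ℝ} (hC1 : 1 ≤ C)
    (hC : ∀ i, i ≤ nbar + 1 → ∀ (A : ℝ) ⦃q e t : ℝ⦄, q ≠ 0 → 0 < e → 0 < t → t * e ≤ Real.exp (-1) →
      |iteratedDeriv i (fun s => cutoff χ (q * pLog p (s * e)) A) t| ≤ C * t ^ (-(i : ℤ)))
    {K₁ : ℝ} (hK₁0 : 0 ≤ K₁) (hK₁ : ∀ Y ∈ Ys, KY Y ≤ K₁) {G : ℕ} (hG : ∀ i, (univ.filter fun τ : ↥B ⊕ ↥Ys => cube τ = i).card ≤ G)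
    {A κ : ℝ} (hA : 0 ≤ A) (hκ : 0 ≤ κ)
    (htail : ∀ (i : I) (b : ↥B), cube (Sum.inl b) = i → ∀ a : ℝ, 0 ≤ a →
      (fieldLaw blk Δ ℱ {i}).real {ω | a ≤ |Φ b (ext blk {i} ω)|} ≤ A * Real.exp (-(κ * a ^ 2)))
    (hekθ : ek ≤ θ) (hreg : ((nbar + 1 : ℕ) : ℝ) + 1 ≤ κ * (81 / 100) * c₀ ^ 2 * Real.log ek⁻¹ ^ (2 * p - 1))
    (hpre : C ^ (nbar + 1) * A * Real.exp (G * K₁) * ek ≤ 1) (hKθ : ∀ Y ∈ Ys, KY Y * Real.exp (G * K₁) ≤ θ)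
    (hvac : Real.exp (G * K₁) * G * A * ek + (Real.exp (G * K₁) - 1) ≤ θ ^ β')
    (h311 : ∀ ρ ∈ (outer W Bl).filter (IsAdmissible adj),
      Vconst + pertP (fun t => Real.log (ztIn blk Δ ℱ χ p ek B Φ c Ys V cube (lam12 W ρ) (lam12' adj W ρ) t)) nbar =
        PL + ∑ X' : Finset I, W6pp ρ X') :
    Real.exp (-Vconst) * expect blk Δ ℱ (fun i φ => fD (uD χ p ek B Φ c Ys V 1) cube γ ∅ i φ * F i φ) W (corner ℝ W) =
      ∑ ρ ∈ (outer W Bl).filter (IsAdmissible adj),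
        (∏ X ∈ ρ, g1 adj (zG blk Δ ℱ (fun i φ => fD (uD χ p ek B Φ c Ys V 1) cube γ ∅ i φ * F i φ)) X) *
          (zG blk Δ ℱ (fun i φ => fD (uD χ p ek B Φ c Ys V 1) cube γ ∅ i φ * F i φ) (lam12 W ρ) (lam12' adj W ρ) /
              zG blk Δ ℱ (fD (uD χ p ek B Φ c Ys V 1) cube γ ∅) (lam12 W ρ) (lam12' adj W ρ) *
            Real.exp (-PL - ∑ X' : Finset I,
              (W6v blk Δ ℱ adj χ p ek B Φ c Ys V cube (lam12' adj W ρ) (lam12 W ρ) L' nbar X' + W6pp ρ X'))) :=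
  eq5145_zG_mod_W6v_of_ineq5144_two_le blk Δ ℱ adj χ cube γ hR hD hnbr hθ0 hθ1 hβ hsmall (fun x y hxy _ => hΔ0 x y hxy) hΔ hχ hp hmod
    hc₀ hcb hV hK hek hek1 hΦloc hVloc F hFloc hL W Bl Vconst PL W6pp hC1 hC hK₁0 hK₁ hG hA hκ htail hekθ hreg hpre hKθ hvac
    (fun ρ _ X' _ t _ γ' H X'' hX'' =>
      abs_locAct_actIn_le_of_two_le blk ℱ adj χ p ek B Φ c Ys V cube hΔ0 hθ0 β' (lam12' adj W ρ) X' t γ' H X'' hX'')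
    h311

end Head

/-! ## §3 Explicit data with χ-slots: sites = cubes, `Δ = 1`, `ℱ = 0`, one linear χ-slot per cube, `θ = √e_k`, `β′ = 1` -/

section Instance

variable {I : Type} [Fintype I] [DecidableEq I] (adj : I → I → Prop) [DecidableRel adj]
  {cube : ↥(univ : Finset I) ⊕ ↥(∅ : Finset I) → I}

/-- **THE MULTI-CUBE HEAD INSTANTIATED ON EXPLICIT §5.13 DATA WITH χ-SLOTS, EVERY HYPOTHESIS DISCHARGED FOR ALL SMALL CHARGES**: sites =
cubes (`blk = id`), `Δ = 1` (block-diagonal, so §2 applies and the multi-cube leaf is discharged by §1), `ℱ = 0`, one χ-slot per cube whose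
slot field is the cube's site field (linear, cube-local; `hmod`, `hΦloc`), thresholds `c ≡ 1`, no interaction terms, profile `gevreyCutoff`
(`χ ≥ 0`), `𝒫^L = 0`, `W₆″_ρ(X′) = [X′ = ∅]·𝒫̃_ρ` (`h311`); the one-cube regime with the all-orders constant `Ĉ(χ, p, n̄+1)` chosen first, the
one-cube Gaussian tails of gen 13's `tail_slotField_fieldLaw_of_mod` (mean `0`, `A = 4`, `κ = 1/(8v)`, `v = 1 + Σ_i Var_i`), one slot per
cube, `θ = √e_k`, `β′ = 1`, and the inequalities `n̄+2 ≤ κ(81/100)|log e_k⁻¹|^{2p−1}`, `e_k < e^{−1}`, `Ĉ^{n̄+1}·4·e_k ≤ 1`, `4e_k ≤ √e_k`,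
`16(D+1)²e²·e_k^{1/4} ≤ 1`, `e_k ≤ 1` for every `e_k` below a threshold `e₀(p, n̄, D, datum) > 0` (`BIJ88SmallChargeRegime.exists_threshold`).
Displayed: a symmetric abutting relation of degree `≤ D`, `p > 1/2`, a cube-local `F`, `n̄`; conclusion: the (5.14.5) identity of the head for
these data, for all `e_k ∈ (0, e₀)`, all `W`, `B_large`, `|L′| = n̄+1`, `γ`. [cite: BalabanImbrieJaffe1988, (5.14.5) p.312; (5.14.4) p.309; p.310 display 4; p.311] -/
theorem eq5145_two_le_instance {nbr : I → Finset I} {D : ℕ}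
    (hR : ∀ x y, adj x y → adj y x) (hD : ∀ x, (nbr x).card ≤ D) (hnbr : ∀ x y, adj x y → y ∈ nbr x)
    (hcube : ∀ b, cube (Sum.inl b) = b.1) {p : ℝ} (hp : 1 / 2 < p)
    (F : I → (I → ℝ) → ℝ) (hFloc : ∀ i (φ ψ : I → ℝ), (∀ x, x = i → φ x = ψ x) → F i φ = F i ψ) (nbar : ℕ) :
    ∃ e₀ : ℝ, 0 < e₀ ∧ ∀ ⦃e : ℝ⦄, 0 < e → e < e₀ →
      ∀ (W Bl : Finset I) {L' : Type} [Fintype L'] [DecidableEq L'] (_ : Fintype.card L' = nbar + 1)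
        {L : Type} (γ : L → ↥(univ : Finset I) ⊕ ↥(∅ : Finset I)),
        Real.exp (-0) * expect (id : I → I) (1 : Matrix I I ℝ) (0 : I → ℝ)
            (fun i φ => fD (uD gevreyCutoff p e (univ : Finset I) (fun (i : I) (φ : I → ℝ) => φ i) (fun _ => (1 : ℝ))
              (∅ : Finset I) (fun (_ : I) (_ : I → ℝ) => (0 : ℝ)) 1) cube γ ∅ i φ * F i φ) W (corner ℝ W) =
          ∑ ρ ∈ (outer W Bl).filter (IsAdmissible adj),
            (∏ X ∈ ρ, g1 adj (zG (id : I → I) (1 : Matrix I I ℝ) (0 : I → ℝ)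
              (fun i φ => fD (uD gevreyCutoff p e (univ : Finset I) (fun (i : I) (φ : I → ℝ) => φ i) (fun _ => (1 : ℝ))
                (∅ : Finset I) (fun (_ : I) (_ : I → ℝ) => (0 : ℝ)) 1) cube γ ∅ i φ * F i φ)) X) *
              (zG (id : I → I) (1 : Matrix I I ℝ) (0 : I → ℝ)
                  (fun i φ => fD (uD gevreyCutoff p e (univ : Finset I) (fun (i : I) (φ : I → ℝ) => φ i) (fun _ => (1 : ℝ))
                    (∅ : Finset I) (fun (_ : I) (_ : I → ℝ) => (0 : ℝ)) 1) cube γ ∅ i φ * F i φ) (lam12 W ρ) (lam12' adj W ρ) /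
                  zG (id : I → I) (1 : Matrix I I ℝ) (0 : I → ℝ)
                    (fD (uD gevreyCutoff p e (univ : Finset I) (fun (i : I) (φ : I → ℝ) => φ i) (fun _ => (1 : ℝ))
                      (∅ : Finset I) (fun (_ : I) (_ : I → ℝ) => (0 : ℝ)) 1) cube γ ∅) (lam12 W ρ) (lam12' adj W ρ) *
                Real.exp (-0 - ∑ X' : Finset I,
                  (W6v (id : I → I) (1 : Matrix I I ℝ) (0 : I → ℝ) adj gevreyCutoff p e (univ : Finset I)
                      (fun (i : I) (φ : I → ℝ) => φ i) (fun _ => (1 : ℝ)) (∅ : Finset I) (fun (_ : I) (_ : I → ℝ) => (0 : ℝ)) cube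
                      (lam12' adj W ρ) (lam12 W ρ) L' nbar X' +
                    (if X' = ∅ then pertP (fun t => Real.log (ztIn (id : I → I) (1 : Matrix I I ℝ) (0 : I → ℝ) gevreyCutoff p e
                      (univ : Finset I) (fun (i : I) (φ : I → ℝ) => φ i) (fun _ => (1 : ℝ)) (∅ : Finset I)
                      (fun (_ : I) (_ : I → ℝ) => (0 : ℝ)) cube (lam12 W ρ) (lam12' adj W ρ) t)) nbar else 0)))) := by
  classical
  -- the all-orders constant of the profile for the orders `≤ n̄+1`, chosen FIRST (before the threshold)
  obtain ⟨C, hC1, hC⟩ := exists_const_all_orders gevreyCutoff p (nbar + 1)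
  -- the one-cube laws `law(□_i)` of the data and a common variance scale `v`
  set v : ℝ := 1 + ∑ i : I, Var[fun ω => (fun φ : I → ℝ => φ i) (ext (id : I → I) ({i} : Finset I) ω);
    fieldLaw (id : I → I) (1 : Matrix I I ℝ) (0 : I → ℝ) {i}] with hv
  have hv1 : ∀ i : I, Var[fun ω => (fun φ : I → ℝ => φ i) (ext (id : I → I) ({i} : Finset I) ω);
      fieldLaw (id : I → I) (1 : Matrix I I ℝ) (0 : I → ℝ) {i}] ≤ v := fun i => by
    have h := single_le_sum (s := (univ : Finset I)) (f := fun i : I => Var[fun ω => (fun φ : I → ℝ => φ i)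
      (ext (id : I → I) ({i} : Finset I) ω); fieldLaw (id : I → I) (1 : Matrix I I ℝ) (0 : I → ℝ) {i}])
      (fun j _ => variance_nonneg _ _) (mem_univ i)
    rw [hv]; linarith
  have hv0 : 0 < v := by
    have := sum_nonneg fun i (_ : i ∈ (univ : Finset I)) => variance_nonneg (fun ω => (fun φ : I → ℝ => φ i)
      (ext (id : I → I) ({i} : Finset I) ω)) (fieldLaw (id : I → I) (1 : Matrix I I ℝ) (0 : I → ℝ) {i})
    rw [hv]; linarith
  have hκ0 : 0 < 1 / (8 * v) * (81 / 100) * (1 : ℝ) ^ 2 := by positivity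
  set M : ℝ := 16 * ((D : ℝ) + 1) ^ 2 * Real.exp 2 with hM
  have hM0 : 0 < M := by positivity
  -- the `e_k`-small regime: every condition holds eventually as `e_k → 0⁺`
  obtain ⟨δ, hδ, hreg⟩ := exists_threshold (Q := fun x : ℝ =>
      (((nbar + 1 : ℕ) : ℝ) + 1 ≤ 1 / (8 * v) * (81 / 100) * (1 : ℝ) ^ 2 * Real.log x⁻¹ ^ (2 * p - 1)) ∧ 2 * Real.exp 1 * x ≤ 1 ∧
        C ^ (nbar + 1) * 4 * x ≤ 1 ∧ 16 * x ≤ 1 ∧ M ^ 4 * x ≤ 1 ∧ x ≤ 1) (by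
    filter_upwards [eventually_const_le_mul_log_rpow (((nbar + 1 : ℕ) : ℝ) + 1) _ (2 * p - 1) hκ0 (by linarith),
      eventually_const_mul_le_one (2 * Real.exp 1), eventually_const_mul_le_one (C ^ (nbar + 1) * 4), eventually_const_mul_le_one 16,
      eventually_const_mul_le_one (M ^ 4), eventually_le_one] with x h1 h2 h3 h4 h5 h6
    exact ⟨h1, h2, h3, h4, h5, h6⟩)
  refine ⟨δ, hδ, ?_⟩
  intro e he heδ W Bl L' _ _ hL L γ
  obtain ⟨h1, h2, h3, h4, h5, h6⟩ := hreg e he heδ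
  -- elementary consequences of the regime
  have hek1 : e < Real.exp (-1) := by
    rw [Real.exp_neg, ← one_div, lt_div_iff₀ (Real.exp_pos 1)]
    nlinarith [Real.exp_pos 1]
  have hsq0 : 0 < Real.sqrt e := Real.sqrt_pos.2 he
  have hsq1 : Real.sqrt e ≤ 1 := by rw [← Real.sqrt_one]; exact Real.sqrt_le_sqrt h6
  have hsqrt : e ≤ Real.sqrt e := by
    calc e = Real.sqrt e * Real.sqrt e := (Real.mul_self_sqrt he.le).symm
      _ ≤ Real.sqrt e * 1 := by gcongr
      _ = Real.sqrt e := mul_one _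
  have hsq4 : Real.sqrt e ≤ 1 / 4 := by
    have h16 : e ≤ (1 / 4) ^ 2 := by nlinarith
    calc Real.sqrt e ≤ Real.sqrt ((1 / 4) ^ 2) := Real.sqrt_le_sqrt h16
      _ = 1 / 4 := Real.sqrt_sq (by norm_num)
  -- gen 5's regime `16(D+1)²e²θ^{β′/2} ≤ 1` at `θ = √e_k`, `β′ = 1`: `θ^{1/2} = √√e_k ≤ 1/M` from `M⁴e_k ≤ 1`
  have hsmall : 16 * ((D : ℝ) + 1) ^ 2 * (Real.sqrt e ^ ((1 : ℝ) / 2) * Real.exp 2) ≤ 1 := by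
    have hx : e ≤ ((1 / M) ^ 2) ^ 2 := by
      rw [← pow_mul, show 2 * 2 = 4 by norm_num, div_pow, one_pow, le_div_iff₀ (pow_pos hM0 4)]; linarith
    have hs1 : Real.sqrt e ≤ (1 / M) ^ 2 := (Real.sqrt_le_left (by positivity)).2 hx
    have hs2 : Real.sqrt (Real.sqrt e) ≤ 1 / M := (Real.sqrt_le_left (by positivity)).2 hs1
    rw [← Real.sqrt_eq_rpow]
    calc 16 * ((D : ℝ) + 1) ^ 2 * (Real.sqrt (Real.sqrt e) * Real.exp 2) = M * Real.sqrt (Real.sqrt e) := by rw [hM]; ring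
      _ ≤ M * (1 / M) := by gcongr
      _ = 1 := by field_simp
  -- the χ-slot fields: linear, cube-local, one per cube; their one-cube laws: `Δ ≻ 0` corners, mean `0`, variance `≤ v`, Gaussian tails
  have hlin : ∀ i : I, IsLinearMap ℝ (fun φ : I → ℝ => φ i) := fun i => (LinearMap.proj (R := ℝ) (φ := fun _ : I => ℝ) i).isLinear
  have hPD : ∀ i : I, (prec (id : I → I) (1 : Matrix I I ℝ) ({i} : Finset I) (corner ℝ ({i} : Finset I))).PosDef := fun i =>
    prec_corner_posDef (id : I → I) (1 : Matrix I I ℝ) Matrix.PosDef.one {i} {i}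
  have hmean : ∀ i : I, |∫ ω, (fun φ : I → ℝ => φ i) (ext (id : I → I) ({i} : Finset I) ω)
      ∂(fieldLaw (id : I → I) (1 : Matrix I I ℝ) (0 : I → ℝ) {i})| ≤ 0 := fun i => by
    rw [BIJ88EffectiveActionGauss308.integral_slotField_fieldLaw (id : I → I) (1 : Matrix I I ℝ) (0 : I → ℝ) {i}
      (Φ := fun (i : I) (φ : I → ℝ) => φ i) (hPD i) (b := i) (hlin i),
      BIJ88EffectiveActionGauss308.slotField_meanField_eq_zero_of_zero (id : I → I) (1 : Matrix I I ℝ) {i}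
      (Φ := fun (i : I) (φ : I → ℝ) => φ i) (b := i) (hlin i), abs_zero]
  have htail : ∀ (i : I) (b : ↥(univ : Finset I)), cube (Sum.inl b) = i → ∀ a : ℝ, 0 ≤ a →
      (fieldLaw (id : I → I) (1 : Matrix I I ℝ) (0 : I → ℝ) {i}).real
        {ω | a ≤ |(fun (i : I) (φ : I → ℝ) => φ i) b (ext (id : I → I) {i} ω)|} ≤
          4 * Real.exp (0 ^ 2 / (2 * v)) * Real.exp (-(1 / (8 * v) * a ^ 2)) := by
    intro i b hbi a ha
    rw [hcube] at hbi
    subst hbi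
    exact BIJ88GaussShellModulus309.tail_slotField_fieldLaw_of_mod (id : I → I) (1 : Matrix I I ℝ) (0 : I → ℝ) {(b : I)} (hPD b)
      (hlin b) (hlin b) (Or.inl fun _ => rfl) (hmean b) (hmean b) hv0 (hv1 b) (hv1 b) ha
  have hG : ∀ i : I, (univ.filter fun τ : ↥(univ : Finset I) ⊕ ↥(∅ : Finset I) => cube τ = i).card ≤ 1 := fun i =>
    card_le_one.2 fun a ha b hb => by
      obtain ⟨-, ha⟩ := mem_filter.1 ha
      obtain ⟨-, hb⟩ := mem_filter.1 hb
      rcases a with a | a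
      · rcases b with b | b
        · rw [hcube] at ha hb
          rw [Subtype.ext (ha.trans hb.symm)]
        · exact absurd b.2 (notMem_empty _)
      · exact absurd a.2 (notMem_empty _)
  -- the remaining regime inequalities in the shape of the head (`G = 1` slot per cube, `K₁ = 0`, `A = 4`, `θ = √e_k`, `β′ = 1`)
  have hpre : C ^ (nbar + 1) * (4 * Real.exp (0 ^ 2 / (2 * v))) * Real.exp (((1 : ℕ) : ℝ) * 0) * e ≤ 1 := by
    have : C ^ (nbar + 1) * (4 * Real.exp (0 ^ 2 / (2 * v))) * Real.exp (((1 : ℕ) : ℝ) * 0) * e = C ^ (nbar + 1) * 4 * e := by simp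
    rw [this]; exact h3
  have hvac : Real.exp (((1 : ℕ) : ℝ) * 0) * ((1 : ℕ) : ℝ) * (4 * Real.exp (0 ^ 2 / (2 * v))) * e + (Real.exp (((1 : ℕ) : ℝ) * 0) - 1) ≤
      Real.sqrt e ^ (1 : ℝ) := by
    have : Real.exp (((1 : ℕ) : ℝ) * 0) * ((1 : ℕ) : ℝ) * (4 * Real.exp (0 ^ 2 / (2 * v))) * e + (Real.exp (((1 : ℕ) : ℝ) * 0) - 1) =
        4 * e := by simp
    rw [this, Real.rpow_one]
    calc 4 * e = (4 * Real.sqrt e) * Real.sqrt e := by rw [mul_assoc, Real.mul_self_sqrt he.le]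
      _ ≤ 1 * Real.sqrt e := by gcongr; linarith
      _ = Real.sqrt e := one_mul _
  exact eq5145_zG_mod_W6v_two_le_blockDiag (id : I → I) (1 : Matrix I I ℝ) (0 : I → ℝ) adj gevreyCutoff cube γ (θ := Real.sqrt e)
    (β' := 1) hR hD hnbr hsq0 hsq1 zero_le_one hsmall (fun x y hxy => Matrix.one_apply_ne hxy) Matrix.PosDef.one chi1_nonneg hp
    (fun b _ => ⟨fun φ => φ b, fun φ => φ b, hlin b, hlin b, Or.inl fun _ => rfl⟩) one_pos (fun _ _ => le_rfl)
    (fun Y hY => absurd hY (notMem_empty Y)) (KY := fun _ => 0) (fun Y hY => absurd hY (notMem_empty Y)) he hek1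
    (fun b φ ψ h => h b.1 (by rw [hcube]; rfl)) (fun Y => absurd Y.2 (notMem_empty _)) F (fun i φ ψ h => hFloc i φ ψ fun x hx => h x hx)
    hL W Bl 0 0
    (fun ρ X' => if X' = ∅ then pertP (fun t => Real.log (ztIn (id : I → I) (1 : Matrix I I ℝ) (0 : I → ℝ) gevreyCutoff p e
      (univ : Finset I) (fun (i : I) (φ : I → ℝ) => φ i) (fun _ => (1 : ℝ)) (∅ : Finset I) (fun (_ : I) (_ : I → ℝ) => (0 : ℝ)) cube
      (lam12 W ρ) (lam12' adj W ρ) t)) nbar else 0)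
    hC1 hC (K₁ := 0) le_rfl (fun Y hY => absurd hY (notMem_empty Y)) (G := 1) hG (by positivity) (by positivity) htail hsqrt h1 hpre
    (fun Y hY => absurd hY (notMem_empty Y)) hvac (fun ρ _ => by simp)

end Instance

/-! ## §4 Everything fixed: two abutting cubes — a closed theorem -/

/-- **THE MULTI-CUBE HEAD WITH EVERYTHING FIXED — A CLOSED THEOREM, NO HYPOTHESES**: two abutting cubes `I = Fin 2` (`adj = (≠)`, degree
`D = 2`; so two-cube polymers exist and are covered by §1), sites = cubes, `Δ = 1`, `ℱ = 0`, one linear χ-slot per cube (cube map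
`Sum.elim val val`), `c ≡ 1`, no interaction terms, `χ = gevreyCutoff`, `p = 1`, `F ≡ 1`, `n̄ = 0`, `L′ = Unit`, `𝒫^L = 0`,
`W₆″_ρ(X′) = [X′ = ∅]·𝒫̃_ρ`: there is `e₀ > 0` such that for every charge `e_k ∈ (0, e₀)`, every `W`, `B_large` and every assignment `γ` the
(5.14.5) identity of `BIJ88Eq5145HeadMultiCube.eq5145_zG_mod_W6v_of_ineq5144_two_le` holds — its hypothesis family (one-cube regime block,
gen 5's regime, `hmod`, `htail`, `h311`, …, and the multi-cube leaf) is JOINTLY satisfiable, kernel-checked.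
[cite: BalabanImbrieJaffe1988, (5.14.5) p.312; (5.14.4) p.309] -/
theorem eq5145_two_le_instance_fin2 :
    ∃ e₀ : ℝ, 0 < e₀ ∧ ∀ ⦃e : ℝ⦄, 0 < e → e < e₀ →
      ∀ (W Bl : Finset (Fin 2)) {L : Type} (γ : L → ↥(univ : Finset (Fin 2)) ⊕ ↥(∅ : Finset (Fin 2))),
        Real.exp (-0) * expect (id : Fin 2 → Fin 2) (1 : Matrix (Fin 2) (Fin 2) ℝ) (0 : Fin 2 → ℝ)
            (fun i φ => fD (uD gevreyCutoff 1 e (univ : Finset (Fin 2)) (fun (i : Fin 2) (φ : Fin 2 → ℝ) => φ i) (fun _ => (1 : ℝ))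
              (∅ : Finset (Fin 2)) (fun (_ : Fin 2) (_ : Fin 2 → ℝ) => (0 : ℝ)) 1)
              (Sum.elim (fun b : ↥(univ : Finset (Fin 2)) => (b : Fin 2)) (fun Y : ↥(∅ : Finset (Fin 2)) => (Y : Fin 2))) γ ∅ i φ *
              (fun (_ : Fin 2) (_ : Fin 2 → ℝ) => (1 : ℝ)) i φ) W (corner ℝ W) =
          ∑ ρ ∈ (outer W Bl).filter (IsAdmissible fun x y : Fin 2 => x ≠ y),
            (∏ X ∈ ρ, g1 (fun x y : Fin 2 => x ≠ y) (zG (id : Fin 2 → Fin 2) (1 : Matrix (Fin 2) (Fin 2) ℝ) (0 : Fin 2 → ℝ)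
              (fun i φ => fD (uD gevreyCutoff 1 e (univ : Finset (Fin 2)) (fun (i : Fin 2) (φ : Fin 2 → ℝ) => φ i) (fun _ => (1 : ℝ))
                (∅ : Finset (Fin 2)) (fun (_ : Fin 2) (_ : Fin 2 → ℝ) => (0 : ℝ)) 1)
                (Sum.elim (fun b : ↥(univ : Finset (Fin 2)) => (b : Fin 2)) (fun Y : ↥(∅ : Finset (Fin 2)) => (Y : Fin 2))) γ ∅ i φ *
                (fun (_ : Fin 2) (_ : Fin 2 → ℝ) => (1 : ℝ)) i φ)) X) *
              (zG (id : Fin 2 → Fin 2) (1 : Matrix (Fin 2) (Fin 2) ℝ) (0 : Fin 2 → ℝ)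
                  (fun i φ => fD (uD gevreyCutoff 1 e (univ : Finset (Fin 2)) (fun (i : Fin 2) (φ : Fin 2 → ℝ) => φ i) (fun _ => (1 : ℝ))
                    (∅ : Finset (Fin 2)) (fun (_ : Fin 2) (_ : Fin 2 → ℝ) => (0 : ℝ)) 1)
                    (Sum.elim (fun b : ↥(univ : Finset (Fin 2)) => (b : Fin 2)) (fun Y : ↥(∅ : Finset (Fin 2)) => (Y : Fin 2))) γ ∅ i φ *
                    (fun (_ : Fin 2) (_ : Fin 2 → ℝ) => (1 : ℝ)) i φ) (lam12 W ρ) (lam12' (fun x y : Fin 2 => x ≠ y) W ρ) /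
                  zG (id : Fin 2 → Fin 2) (1 : Matrix (Fin 2) (Fin 2) ℝ) (0 : Fin 2 → ℝ)
                    (fD (uD gevreyCutoff 1 e (univ : Finset (Fin 2)) (fun (i : Fin 2) (φ : Fin 2 → ℝ) => φ i) (fun _ => (1 : ℝ))
                      (∅ : Finset (Fin 2)) (fun (_ : Fin 2) (_ : Fin 2 → ℝ) => (0 : ℝ)) 1)
                      (Sum.elim (fun b : ↥(univ : Finset (Fin 2)) => (b : Fin 2)) (fun Y : ↥(∅ : Finset (Fin 2)) => (Y : Fin 2))) γ ∅)
                    (lam12 W ρ) (lam12' (fun x y : Fin 2 => x ≠ y) W ρ) *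
                Real.exp (-0 - ∑ X' : Finset (Fin 2),
                  (W6v (id : Fin 2 → Fin 2) (1 : Matrix (Fin 2) (Fin 2) ℝ) (0 : Fin 2 → ℝ) (fun x y : Fin 2 => x ≠ y) gevreyCutoff 1 e
                      (univ : Finset (Fin 2)) (fun (i : Fin 2) (φ : Fin 2 → ℝ) => φ i) (fun _ => (1 : ℝ)) (∅ : Finset (Fin 2))
                      (fun (_ : Fin 2) (_ : Fin 2 → ℝ) => (0 : ℝ))
                      (Sum.elim (fun b : ↥(univ : Finset (Fin 2)) => (b : Fin 2)) (fun Y : ↥(∅ : Finset (Fin 2)) => (Y : Fin 2)))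
                      (lam12' (fun x y : Fin 2 => x ≠ y) W ρ) (lam12 W ρ) Unit 0 X' +
                    (if X' = ∅ then pertP (fun t => Real.log (ztIn (id : Fin 2 → Fin 2) (1 : Matrix (Fin 2) (Fin 2) ℝ) (0 : Fin 2 → ℝ)
                      gevreyCutoff 1 e (univ : Finset (Fin 2)) (fun (i : Fin 2) (φ : Fin 2 → ℝ) => φ i) (fun _ => (1 : ℝ))
                      (∅ : Finset (Fin 2)) (fun (_ : Fin 2) (_ : Fin 2 → ℝ) => (0 : ℝ))
                      (Sum.elim (fun b : ↥(univ : Finset (Fin 2)) => (b : Fin 2)) (fun Y : ↥(∅ : Finset (Fin 2)) => (Y : Fin 2)))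
                      (lam12 W ρ) (lam12' (fun x y : Fin 2 => x ≠ y) W ρ) t)) 0 else 0)))) := by
  obtain ⟨e₀, he₀, h⟩ := eq5145_two_le_instance (fun x y : Fin 2 => x ≠ y) (nbr := fun _ => univ) (D := 2) (fun _ _ h => Ne.symm h)
    (fun _ => by simp) (fun _ y _ => mem_univ y)
    (cube := Sum.elim (fun b : ↥(univ : Finset (Fin 2)) => (b : Fin 2)) (fun Y : ↥(∅ : Finset (Fin 2)) => (Y : Fin 2))) (fun _ => rfl)
    (p := 1) (by norm_num) (fun (_ : Fin 2) (_ : Fin 2 → ℝ) => (1 : ℝ)) (fun _ _ _ _ => rfl) 0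
  exact ⟨e₀, he₀, fun e he hee W Bl L γ => h he hee W Bl (L' := Unit) (by simp) γ⟩

end Literature.MathematicalPhysics.QuantumFieldTheory.BalabanImbrieJaffe1984to88.BIJ88Eq5145HeadMultiCubeSlots

end
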